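import Summits.RiemannHypothesis.RiemannHypothesis.Theorems.PfPersistenceDialSpaceLeaf
import Summits.RiemannHypothesis.RiemannHypothesis.Theorems.PfPersistenceF6SpectralShift
import Summits.RiemannHypothesis.RiemannHypothesis.Theorems.PfPersistenceGalerkinDownCone
import HarnessLib

/-!
# PF persistence — the ARITHMETIC dial space: append-only re-type of the barrier's domain
(pub-rhpf barrier-typer gen 3; REFEREE r10 §1, RULING A35(a), CASE-DAG §8 R9)

**HONEST FRAMING. This is a long-odds MECHANISM SEARCH; no RH claims.** Nothing below decides any Weil
positivity; every statement is RH-free bookkeeping / locality / perturbation algebra about WHICH perturbed data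
the cell's barriers quantify over. No landed declaration is edited: this file only ADDS sub-domains of
`dialSpace` and re-states the landed barrier theorems on them.

## Why (REFEREE r10 §1 / A35)

`dialSpace = Set.range datumOf` ranges over ALL weight tables `w : ℕ → ℝ`, including mass at `q = 0, 1`
(position `log q = 0`; `Real.log 0 = Real.log 1 = 0`) and at composites. Mass `c` at position `0` is a pure
SPECTRAL SHIFT `−2c·1` of every window block (`F6Shift.evenBlock_shiftWeights`), so as typed the barrier
hypothesis "false on all `dialSpace` negatives" is STRONGER than the charter's "fails every observatory control"
(no registered control family carries mass at position `0`). The referee's ruling: the campaign's arithmetic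
dial space is WEIGHTS ON PRIME POWERS.

## What (three nested TYPED domains, smallest first; all theorems on the smallest are the strongest)

* §1 `arithWeights := {w | ∀ q, ¬ IsPrimePow q → w q = 0}` (r10 §1 VERBATIM), `arithDialSpace := datumOf '' arithWeights`
  — the DOMAIN OF RECORD (A35(a)(i),(iv)); `zetaDatum ∈ arithDialSpace`.
  `originFreeWeights := {w | w 0 = 0 ∧ w 1 = 0}` (no mass at position `0`; composites allowed — this is where the
  registered integer-position families with composite support live, e.g. integer g-prime systems and `primeadd`
  at composite `n`: `addAt_mem_originFreeWeights`), `originFreeDialSpace`;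
  `arithDialSpace ⊆ originFreeDialSpace ⊆ dialSpace` (PROVED).
* §2 closure under the control moves: every pointwise DRESSING `mulWeights f w` (dials `dial p K`, deletions,
  completely-multiplicative twists, `dbl-2`-type power reweightings) preserves both sub-domains; single-position
  additions `addAt n c` preserve `arithWeights` iff `IsPrimePow n` (else only `originFreeWeights`, `2 ≤ n`); the
  `q = 1` shift `F6Shift.shiftWeights w c`, `c ≠ 0`, leaves BOTH (PROVED) — and more: NO origin-free table has the
  shifted datum (§3, `shift_datumOf_not_mem_originFreeDialSpace`, read off the window `a = 1/5 < log 2 / 2`, which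
  sees no position `≥ log 2`). Contrast `F6Shift.shift_zetaDatum_mem_dialSpace` (as typed).
* §4 the landed barrier theorems RE-STATED with witnesses in `arithDialSpace` (one line each: the locality witness
  is a heavy PRIME dial of `ζ`, the W2 witness a small prime dial of `ζ`; `dial p K` preserves `arithWeights`):
  `finitelyDetermined_meets_arithDialNegativesNe`, `finitelyRobustAt_meets_arithDialNegativesNe`,
  `not_separates_of_finitelyDetermined_arith`; `negativesAccumulateNe_arithDialSpace`,
  `uniformlyRobustAt_contains_negative_arithDial`, `not_separates_of_uniformlyRobust_arith` — **modulo the TYPED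
  `DialReady p β₀` ONLY** (the guarded form bound `primePatternFormBoundedOn` is PROVED for every `p` in
  `PfPersistenceDialSpaceLeaf` rev. 2, 5d1bb1ec17e1; A35(a)(iii): on `arithDialSpace` the accumulation input stays
  `DialReady`, while the `GalerkinInfZero`-only accumulation `F6Shift.negativesAccumulateNe_dialSpace_of_galerkinInfZero`
  uses the non-arithmetic shift and does NOT transfer); and T0 on the arithmetic domain
  `criterion_in_C_iff_weilPositivity_arith`. Monotonicity in the domain is PROVED
  (`Separates.anti`, `NegativesAccumulateNe.mono`): a row 'closed on dialSpace' whose kernel witness is a prime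
  dial KEEPS its label on `arithDialSpace` (A35(a)(ii)); a row whose only witness is the `q = 1` shift is
  'closed on dialSpace-AS-TYPED (non-arithmetic shift; outside the tally)'.

Labels: PROVED = kernel-checked here or in the imported tree files; TYPED = `DialReady` (hypothesis, never
asserted); no DATA enters this file.
-/

set_option linter.dupNamespace false  -- the mandated namespace repeats `RiemannHypothesis`

noncomputable section

open Real Finset Matrix

namespace Summit.RiemannHypothesis.RiemannHypothesis.Theorems.PfPersistence

/-! ## §1 The arithmetic sub-domains of `dialSpace` -/

/-- ARITHMETIC weight tables: supported on prime powers `q = p^k`, `k ≥ 1` (REFEREE r10 §1 verbatim; in particular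
`w 0 = w 1 = 0` and no composites). [folklore] -/
def arithWeights : Set Weights := {w | ∀ q, ¬ IsPrimePow q → w q = 0}

/-- ORIGIN-FREE weight tables: no mass at the position `log q = 0`, i.e. `w 0 = w 1 = 0` (composite positions
allowed: integer g-prime systems, `primeadd` at composite `n`). [folklore] -/
def originFreeWeights : Set Weights := {w | w 0 = 0 ∧ w 1 = 0}

/-- PROVED: arithmetic tables are origin-free (`0` and `1` are not prime powers). [folklore] -/
theorem arithWeights_subset_originFreeWeights : arithWeights ⊆ originFreeWeights :=
  fun _ hw => ⟨hw 0 not_isPrimePow_zero, hw 1 not_isPrimePow_one⟩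

/-- the ARITHMETIC DIAL SPACE — domain of record for every barrier hypothesis 'false on every negative control'
(A35(a)(iv)): data of prime-power supported tables. [folklore] -/
def arithDialSpace : Set Datum := datumOf '' arithWeights

/-- the ORIGIN-FREE dial space: data of tables with no mass at position `0`. [folklore] -/
def originFreeDialSpace : Set Datum := datumOf '' originFreeWeights

/-- PROVED: `arithDialSpace ⊆ originFreeDialSpace`. [folklore] -/
theorem arithDialSpace_subset_originFreeDialSpace : arithDialSpace ⊆ originFreeDialSpace := by
  rintro d ⟨w, hw, rfl⟩
  exact ⟨w, arithWeights_subset_originFreeWeights hw, rfl⟩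

/-- PROVED: `originFreeDialSpace ⊆ dialSpace`. [folklore] -/
theorem originFreeDialSpace_subset_dialSpace : originFreeDialSpace ⊆ dialSpace := by
  rintro d ⟨w, -, rfl⟩
  exact ⟨w, rfl⟩

/-- PROVED: `arithDialSpace ⊆ dialSpace`. [folklore] -/
theorem arithDialSpace_subset_dialSpace : arithDialSpace ⊆ dialSpace := by
  rintro d ⟨w, -, rfl⟩
  exact ⟨w, rfl⟩

/-- PROVED: `ζ`'s table `Λ(q) q^{-1/2}` is arithmetic (`Λ` vanishes off prime powers). [folklore] -/
theorem zetaWeights_mem_arithWeights : zetaWeights ∈ arithWeights := by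
  intro q hq
  simp [zetaWeights, ArithmeticFunction.vonMangoldt_apply, hq]

/-- PROVED: `ζ ∈ arithDialSpace`. [folklore] -/
theorem zetaDatum_mem_arithDialSpace : zetaDatum ∈ arithDialSpace :=
  ⟨zetaWeights, zetaWeights_mem_arithWeights, rfl⟩

/-- PROVED: `ζ ∈ originFreeDialSpace`. [folklore] -/
theorem zetaDatum_mem_originFreeDialSpace : zetaDatum ∈ originFreeDialSpace :=
  arithDialSpace_subset_originFreeDialSpace zetaDatum_mem_arithDialSpace

/-! ## §2 Closure under the control moves; the `q = 1` shift leaves -/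

/-- pointwise DRESSING of a table by a factor table `f`: `q ↦ f q · w q` (dials, deletions `f p = 0`, completely
multiplicative twists `|f| ≤ 1`, power reweightings such as `dbl-2`). [folklore] -/
def mulWeights (f : ℕ → ℝ) (w : Weights) : Weights := fun q => f q * w q

/-- PROVED: dressings preserve arithmetic support. [folklore] -/
theorem mulWeights_mem_arithWeights (f : ℕ → ℝ) {w : Weights} (hw : w ∈ arithWeights) :
    mulWeights f w ∈ arithWeights := fun q hq => by simp [mulWeights, hw q hq]

/-- PROVED: dressings preserve origin-freeness. [folklore] -/
theorem mulWeights_mem_originFreeWeights (f : ℕ → ℝ) {w : Weights} (hw : w ∈ originFreeWeights) :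
    mulWeights f w ∈ originFreeWeights :=
  ⟨by simp [mulWeights, hw.1], by simp [mulWeights, hw.2]⟩

/-- PROVED: the `p`-dial is the dressing by `K` at `p`, `1` elsewhere. [folklore] -/
theorem dial_eq_mulWeights (p : ℕ) (K : ℝ) (w : Weights) :
    dial p K w = mulWeights (fun q => if q = p then K else 1) w := by
  funext q
  by_cases h : q = p <;> simp [dial, mulWeights, h]

/-- PROVED: dials preserve arithmetic support. [folklore] -/
theorem dial_mem_arithWeights (p : ℕ) (K : ℝ) {w : Weights} (hw : w ∈ arithWeights) :
    dial p K w ∈ arithWeights := by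
  intro q hq
  simp [dial, hw q hq]

/-- PROVED: dials preserve origin-freeness. [folklore] -/
theorem dial_mem_originFreeWeights (p : ℕ) (K : ℝ) {w : Weights} (hw : w ∈ originFreeWeights) :
    dial p K w ∈ originFreeWeights :=
  ⟨by simp [dial, hw.1], by simp [dial, hw.2]⟩

/-- PROVED: every dial of `ζ` is an arithmetic datum (the barrier witnesses live in `arithDialSpace`). [folklore] -/
theorem datumOf_dial_zeta_mem_arithDialSpace (p : ℕ) (K : ℝ) :
    datumOf (dial p K zetaWeights) ∈ arithDialSpace :=
  ⟨_, dial_mem_arithWeights p K zetaWeights_mem_arithWeights, rfl⟩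

/-- PROVED: every dressing of `ζ` is an arithmetic datum (`dbl-2`, RMF twists, deletions, composite dials). [folklore] -/
theorem datumOf_mulWeights_zeta_mem_arithDialSpace (f : ℕ → ℝ) :
    datumOf (mulWeights f zetaWeights) ∈ arithDialSpace :=
  ⟨_, mulWeights_mem_arithWeights f zetaWeights_mem_arithWeights, rfl⟩

/-- ADD MASS `c` at the single position `n` (planted prime-power atom for `IsPrimePow n`; `primeadd` at composite
`n`; the `q = 1` spectral shift for `n = 1`). [folklore] -/
def addAt (n : ℕ) (c : ℝ) (w : Weights) : Weights := fun q => if q = n then w q + c else w q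

/-- PROVED: the F6 shift table IS `addAt 1`. [folklore] -/
theorem shiftWeights_eq_addAt (w : Weights) (c : ℝ) : F6Shift.shiftWeights w c = addAt 1 c w := rfl

/-- PROVED: adding mass at a prime power keeps a table arithmetic. [folklore] -/
theorem addAt_mem_arithWeights {n : ℕ} (hn : IsPrimePow n) (c : ℝ) {w : Weights} (hw : w ∈ arithWeights) :
    addAt n c w ∈ arithWeights := by
  intro q hq
  have hqn : q ≠ n := fun h => hq (h ▸ hn)
  simp [addAt, hqn, hw q hq]

/-- PROVED: adding mass `c ≠ 0` at a NON-prime-power position leaves `arithWeights` (composite `primeadd`, and the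
`q = 1` shift). [folklore] -/
theorem addAt_not_mem_arithWeights {n : ℕ} (hn : ¬ IsPrimePow n) {c : ℝ} (hc : c ≠ 0) {w : Weights}
    (hw : w ∈ arithWeights) : addAt n c w ∉ arithWeights := by
  intro h
  have h1 : w n + c = 0 := by simpa [addAt] using h n hn
  rw [hw n hn, zero_add] at h1
  exact hc h1

/-- PROVED: adding mass at any position `n ≥ 2` keeps a table origin-free (composite positions included). [folklore] -/
theorem addAt_mem_originFreeWeights {n : ℕ} (hn : 2 ≤ n) (c : ℝ) {w : Weights} (hw : w ∈ originFreeWeights) :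
    addAt n c w ∈ originFreeWeights := by
  have h0 : (0 : ℕ) ≠ n := by omega
  have h1 : (1 : ℕ) ≠ n := by omega
  exact ⟨by simp [addAt, h0, hw.1], by simp [addAt, h1, hw.2]⟩

/-- PROVED: the `q = 1` shift by `c ≠ 0` of an origin-free table is NOT origin-free. [folklore] -/
theorem shiftWeights_not_mem_originFreeWeights {w : Weights} (hw : w ∈ originFreeWeights) {c : ℝ} (hc : c ≠ 0) :
    F6Shift.shiftWeights w c ∉ originFreeWeights := by
  intro h
  have h2 : w 1 + c = 0 := by simpa [F6Shift.shiftWeights] using h.2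
  rw [hw.2, zero_add] at h2
  exact hc h2

/-- PROVED: the `q = 1` shift by `c ≠ 0` of an arithmetic table is NOT arithmetic (REFEREE r10 §1: F6's
`shiftInvariant_unsound` witness lies outside the arithmetic dial space). [folklore] -/
theorem shiftWeights_not_mem_arithWeights {w : Weights} (hw : w ∈ arithWeights) {c : ℝ} (hc : c ≠ 0) :
    F6Shift.shiftWeights w c ∉ arithWeights := fun h =>
  shiftWeights_not_mem_originFreeWeights (arithWeights_subset_originFreeWeights hw) hc
    (arithWeights_subset_originFreeWeights h)

/-! ## §3 Windows below `log 2 / 2` see no origin-free mass: the shifted DATUM is not origin-free -/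

/-- PROVED: for `0 ≤ L` with `e^L < 2` the positions met by a support of length `L` are `q ∈ {0, 1}` only. [folklore] -/
theorem primeRange_eq_range_two {L : ℝ} (h0 : 0 ≤ L) (h2 : Real.exp L < 2) : primeRange L = Finset.range 2 := by
  have h1 : (1 : ℝ) ≤ Real.exp L := by have := Real.add_one_le_exp L; linarith
  have hfl : ⌊Real.exp L⌋₊ = 1 := by
    rw [Nat.floor_eq_iff (Real.exp_pos L).le]
    constructor
    · exact_mod_cast h1
    · push_cast; linarith
  simp [primeRange, hfl]

/-- PROVED: an origin-free table has NO prime part on a support of length `L`, `e^L < 2`. [folklore] -/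
theorem WP_eq_zero_of_originFree {w : Weights} (hw : w ∈ originFreeWeights) {L : ℝ} (h0 : 0 ≤ L)
    (h2 : Real.exp L < 2) (Θ : ℝ → ℝ) : WP L w Θ = 0 := by
  have hw0 : w 0 = 0 := hw.1
  have hw1 : w 1 = 0 := hw.2
  simp [WP, primeRange_eq_range_two h0 h2, Finset.sum_range_succ, hw0, hw1]

/-- PROVED (locality below the first position): all origin-free tables have THE SAME even block at every window
with `e^{2a} < 2` (`a < log 2 / 2 ≈ 0.3466`): polar minus archimedean part, no primes. [folklore] -/
theorem evenBlock_eq_of_originFree {w w' : Weights} (hw : w ∈ originFreeWeights) (hw' : w' ∈ originFreeWeights)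
    {win : Window} (h2 : Real.exp (2 * win.a) < 2) : evenBlock w win = evenBlock w' win := by
  have h0 : 0 ≤ 2 * win.a := by have := win.ha; positivity
  ext n m
  simp only [evenBlock, weil, WP_eq_zero_of_originFree hw h0 h2, WP_eq_zero_of_originFree hw' h0 h2]

/-- the LOW WINDOW `(a, N) = (1/5, 0)`: genuine (`0 < a`) and below the first position (`e^{2/5} < 2`). [folklore] -/
def lowWindow : Window := ⟨1 / 5, 0, by norm_num⟩

/-- `lowWindow.a = 1/5`. [folklore] -/
theorem lowWindow_a : lowWindow.a = 1 / 5 := rfl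

/-- PROVED: `e^{2·(1/5)} < 2` (`2/5 < log 2`, `Real.log_two_gt_d9`). [folklore] -/
theorem exp_two_mul_lowWindow_a_lt_two : Real.exp (2 * lowWindow.a) < 2 := by
  rw [lowWindow_a]
  have hlog : (2 : ℝ) * (1 / 5) < Real.log 2 := by
    have := Real.log_two_gt_d9
    norm_num at this ⊢
    linarith
  calc Real.exp (2 * (1 / 5)) < Real.exp (Real.log 2) := Real.exp_lt_exp.2 hlog
    _ = 2 := Real.exp_log (by norm_num)

/-- **PROVED: the spectral shift `δ ≠ 0` of an origin-free datum is the datum of NO origin-free table** (compare the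
`(0,0)` entries at `lowWindow`, where all origin-free tables agree). So the F6 shift family, inside `dialSpace` as
typed (`F6Shift.shift_zetaDatum_mem_dialSpace`), is OUTSIDE `originFreeDialSpace ⊇ arithDialSpace`. [folklore] -/
theorem shift_datumOf_not_mem_originFreeDialSpace {w : Weights} (hw : w ∈ originFreeWeights) {δ : ℝ}
    (hδ : δ ≠ 0) : shift δ (datumOf w) ∉ originFreeDialSpace := by
  rintro ⟨w', hw', h⟩
  have h00 := congrArg (fun d : Datum => d lowWindow 0 0) h
  simp only [datumOf, shift, Matrix.sub_apply, Matrix.smul_apply, Matrix.one_apply_eq, smul_eq_mul,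
    mul_one] at h00
  rw [evenBlock_eq_of_originFree hw' hw exp_two_mul_lowWindow_a_lt_two] at h00
  exact hδ (by linarith)

/-- PROVED: `shift δ ζ ∉ originFreeDialSpace` for `δ ≠ 0`. [folklore] -/
theorem shift_zetaDatum_not_mem_originFreeDialSpace {δ : ℝ} (hδ : δ ≠ 0) :
    shift δ zetaDatum ∉ originFreeDialSpace :=
  shift_datumOf_not_mem_originFreeDialSpace (arithWeights_subset_originFreeWeights zetaWeights_mem_arithWeights) hδ

/-- PROVED: `shift δ ζ ∉ arithDialSpace` for `δ ≠ 0` (the D-SHIFT / `shiftInvariant_unsound` witness is not an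
arithmetic control: A35(a)(ii), row label 'closed on dialSpace-AS-TYPED'). [folklore] -/
theorem shift_zetaDatum_not_mem_arithDialSpace {δ : ℝ} (hδ : δ ≠ 0) : shift δ zetaDatum ∉ arithDialSpace :=
  fun h => shift_zetaDatum_not_mem_originFreeDialSpace hδ (arithDialSpace_subset_originFreeDialSpace h)

/-- PROVED: the datum of the shifted table `F6Shift.shiftWeights w c`, `c ≠ 0`, `w` origin-free, is not
origin-free-representable either (`shift (2c) (datumOf w) = datumOf (shiftWeights w c)`). [folklore] -/
theorem datumOf_shiftWeights_not_mem_originFreeDialSpace {w : Weights} (hw : w ∈ originFreeWeights) {c : ℝ}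
    (hc : c ≠ 0) : datumOf (F6Shift.shiftWeights w c) ∉ originFreeDialSpace := by
  rw [← F6Shift.shift_datumOf]
  exact shift_datumOf_not_mem_originFreeDialSpace hw (by positivity)

/-! ## §4 The barriers on the arithmetic domain (witnesses are prime dials of `ζ`) -/

/-- PROVED: separation is ANTITONE in the domain — sound on a larger domain ⇒ sound on a smaller one; hence every
`¬ Separates` on `arithDialSpace` below implies the landed `dialSpace` statement, not conversely. [folklore] -/
theorem Separates.anti {S D D' : Set Datum} {d₀ : Datum} (h : Separates S D' d₀) (hD : D ⊆ D') :
    Separates S D d₀ :=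
  ⟨h.1, fun d hd hneg => h.2 d (hD hd) hneg⟩

/-- PROVED: named accumulation is MONOTONE in the domain. [folklore] -/
theorem NegativesAccumulateNe.mono {D D' : Set Datum} {d₀ : Datum} (h : NegativesAccumulateNe D d₀)
    (hD : D ⊆ D') : NegativesAccumulateNe D' d₀ := fun ε hε =>
  let ⟨d, hdD, hne, hneg, hclose⟩ := h ε hε
  ⟨d, hD hdD, hne, hneg, hclose⟩

/-- PROVED: accumulation is MONOTONE in the domain. [folklore] -/
theorem NegativesAccumulate.mono {D D' : Set Datum} {d₀ : Datum} (h : NegativesAccumulate D d₀)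
    (hD : D ⊆ D') : NegativesAccumulate D' d₀ := fun ε hε =>
  let ⟨d, hdD, hneg, hclose⟩ := h ε hε
  ⟨d, hD hdD, hneg, hclose⟩

/-- **PROVED — THE LOCALITY BARRIER on the arithmetic domain (RH-free; T-W1 keeps its label, A35(a)(ii)).** Every
finitely determined criterion containing `ζ` contains an ARITHMETIC datum `≠ ζ` (a heavy prime dial of `ζ`) that
is detectably negative at a genuine window. [folklore] -/
theorem finitelyDetermined_meets_arithDialNegativesNe {S : Set Datum} (hS : FinitelyDetermined S)
    (hζ : zetaDatum ∈ S) : ∃ d ∈ arithDialSpace, d ≠ zetaDatum ∧ d ∈ S ∧ DetectablyNegative d := by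
  obtain ⟨p, hp, K, hK, hmem, v, hv⟩ := exists_heavyDial_mem_negative hS hζ
  exact ⟨datumOf (dial p K zetaWeights), datumOf_dial_zeta_mem_arithDialSpace p K,
    datumOf_dial_ne hp.two_le hK.ne' (zetaWeights_pos_of_prime hp).ne', hmem, logWindow p hp.two_le, v, hv⟩

/-- PROVED: the same for `τ_fin`-robust criteria at `ζ`. [folklore] -/
theorem finitelyRobustAt_meets_arithDialNegativesNe {S : Set Datum} (hS : FinitelyRobustAt S zetaDatum) :
    ∃ d ∈ arithDialSpace, d ≠ zetaDatum ∧ d ∈ S ∧ DetectablyNegative d := by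
  obtain ⟨S', hS'S, hζ, hfd⟩ := hS.exists_finitelyDetermined
  obtain ⟨d, hdD, hne, hdS', hneg⟩ := finitelyDetermined_meets_arithDialNegativesNe hfd hζ
  exact ⟨d, hdD, hne, hS'S hdS', hneg⟩

/-- PROVED: no finitely determined criterion separates `ζ` from the negatives of any domain `D ⊇ arithDialSpace`. [folklore] -/
theorem not_separates_of_finitelyDetermined_arith {S D : Set Datum} (hD : arithDialSpace ⊆ D)
    (hS : FinitelyDetermined S) : ¬ Separates S D zetaDatum := by
  rintro ⟨hζ, hneg⟩
  obtain ⟨d, hdD, -, hdS, hd⟩ := finitelyDetermined_meets_arithDialNegativesNe hS hζ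
  exact hneg d (hD hdD) hd hdS

/-- PROVED: no `τ_fin`-robust criterion at `ζ` separates `ζ` from the negatives of any `D ⊇ arithDialSpace`. [folklore] -/
theorem not_separates_of_finitelyRobustAt_arith {S D : Set Datum} (hD : arithDialSpace ⊆ D)
    (hS : FinitelyRobustAt S zetaDatum) : ¬ Separates S D zetaDatum := by
  rintro ⟨-, hneg⟩
  obtain ⟨d, hdD, -, hdS, hd⟩ := finitelyRobustAt_meets_arithDialNegativesNe hS
  exact hneg d (hD hdD) hd hdS

/-- **PROVED modulo the TYPED `DialReady p β₀` ONLY (in-domain accumulation, named witness, arithmetic domain)**: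
negatives of `arithDialSpace` other than `ζ` accumulate uniformly at `ζ` — small prime dials of `ζ`; the form bound
is discharged by the landed `primePattern_form_abs_le` (= `primePatternFormBoundedOn p`, DialSpaceLeaf rev. 2);
the landed `negativesAccumulateNe_dialSpace_of_dialReady₀` is this statement pushed forward by `.mono`. [folklore] -/
theorem negativesAccumulateNe_arithDialSpace {p : ℕ} {β₀ : ℝ} (hβ₀ : 0 < β₀) (hw : 0 < zetaWeights p)
    (hready : DialReady p β₀) : NegativesAccumulateNe arithDialSpace zetaDatum := by
  intro ε hε
  obtain ⟨K, win, v, -, hne, -, hneg, hclose⟩ := exists_negative_dial_uniformlyClose_ne hβ₀ hw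
    (fun win hp v => primePattern_form_abs_le win.ha hp v) hready hε
  exact ⟨datumOf (dial p K zetaWeights), datumOf_dial_zeta_mem_arithDialSpace p K, hne, ⟨win, v, hneg⟩, hclose⟩

/-- **PROVED (W2 on the arithmetic domain, modulo `DialReady` only)**: every criterion with an `a`-uniform modulus
at `ζ` CONTAINS a detectably negative ARITHMETIC datum `≠ ζ` (a small prime dial). [folklore] -/
theorem uniformlyRobustAt_contains_negative_arithDial {p : ℕ} {β₀ : ℝ} (hβ₀ : 0 < β₀)
    (hw : 0 < zetaWeights p) (hready : DialReady p β₀) {S : Set Datum} (hS : UniformlyRobustAt S zetaDatum) :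
    ∃ d ∈ arithDialSpace, d ≠ zetaDatum ∧ d ∈ S ∧ DetectablyNegative d :=
  not_uniformlyRobust_of_negativesAccumulateNe (negativesAccumulateNe_arithDialSpace hβ₀ hw hready) hS

/-- PROVED: the `p = 2` instance (observatory `λ`-pert / two-sided dial at `q = 2`), modulo `DialReady 2 β₀` only. [folklore] -/
theorem uniformlyRobustAt_contains_negative_arithDial_two {β₀ : ℝ} (hβ₀ : 0 < β₀) (hready : DialReady 2 β₀)
    {S : Set Datum} (hS : UniformlyRobustAt S zetaDatum) :
    ∃ d ∈ arithDialSpace, d ≠ zetaDatum ∧ d ∈ S ∧ DetectablyNegative d :=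
  uniformlyRobustAt_contains_negative_arithDial hβ₀ zetaWeights_two_pos hready hS

/-- PROVED: hence no `τ_unif`-robust criterion separates `ζ` from the negatives of any `D ⊇ arithDialSpace`
(modulo `DialReady` only). [folklore] -/
theorem not_separates_of_uniformlyRobust_arith {p : ℕ} {β₀ : ℝ} (hβ₀ : 0 < β₀) (hw : 0 < zetaWeights p)
    (hready : DialReady p β₀) {S D : Set Datum} (hD : arithDialSpace ⊆ D) (hS : UniformlyRobustAt S zetaDatum) :
    ¬ Separates S D zetaDatum := by
  rintro ⟨-, hneg⟩
  obtain ⟨d, hdD, -, hdS, hd⟩ := uniformlyRobustAt_contains_negative_arithDial hβ₀ hw hready hS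
  exact hneg d (hD hdD) hd hdS

/-- **PROVED (T0 on the arithmetic domain)**: for every class `𝒞 ∋ 𝒫`, some member separates `ζ` from the
negatives of `arithDialSpace` iff `ζ` is positive at all windows — the same bookkeeping equivalence, both sides
OPEN; the re-type changes no status word of T-W3. [folklore] -/
theorem criterion_in_C_iff_weilPositivity_arith (𝒞 : Set (Set Datum)) (h𝒫 : positiveClass ∈ 𝒞) :
    (∃ S ∈ 𝒞, Separates S arithDialSpace zetaDatum) ↔ AllWindowsPositive zetaDatum :=
  pfPersistence_criterion_in_C_iff_weilPositivity 𝒞 h𝒫 arithDialSpace zetaDatum_mem_arithDialSpace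

/-- PROVED (bookkeeping for row authors): a criterion sound on `dialSpace` is sound on `arithDialSpace`; the
converse direction is exactly what the `q = 1` shift obstructs for shift-invariant criteria. [folklore] -/
theorem separates_arith_of_separates_dialSpace {S : Set Datum} {d₀ : Datum} (h : Separates S dialSpace d₀) :
    Separates S arithDialSpace d₀ :=
  h.anti arithDialSpace_subset_dialSpace

end Summit.RiemannHypothesis.RiemannHypothesis.Theorems.PfPersistence

end
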